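import Summits.CriticalPhenomena.CardyFormulaZ2.Theorems.CardyMagicRigidityNestingRigidityTomographySelection
import Summits.CriticalPhenomena.CardyFormulaZ2.Theorems.CardyMagicRigidityNestingRigidityTomographyDictionary
import Summits.CriticalPhenomena.CardyFormulaZ2.Theorems.CardyMagicRigidityNestingRigidityNeckFourArmInputsT
import Literature.Probability.Percolation.AnnulusAlternationThin
import Literature.Probability.Percolation.AnnulusHookup
import HarnessLib

/-!
# Disc duality at a clean collar: `TDiscDuality` holds

Crux `Summit.CriticalPhenomena.CardyFormulaZ2.Theses.CardyMagicRigidity.NestingRigidity` (stmt-CriticalPhenomena-4835),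
line `pinch-resampling` v4, stub S10' `stub_neckTomographyV4`.  The first of the two PLANAR inputs of the blob-graph
structure D1 named in `…NestingRigidityTomographySelection` (p160817) is proved here (registered anchor
`tDiscDuality_holds : TDiscDuality`): on the selection event `TPinch x x s s` (exactly two open and exactly two closed
crossing clusters of the collar `Λ_{2s}(x) ∖ Λ_s(x)` of `𝕋`), the open crossings are NOT all joined by an open path of
`Λ_{2s}(x)` iff the closed crossings ARE all joined by a closed path of `Λ_{2s}(x)`.  Consequently the CLOSED
dictionary `tGlue_false_tState_iff_reachable` of `…NestingRigidityTomographyDictionary` becomes unconditional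
(`tGlue_false_tState_iff_reachable'`).

* §1 dictionary between the cluster-form vocabulary at centre `x` (`tBall`, `tColourGraph`, `innerLayer`,
  `outerLayer`, `IsCrossing`) and `𝕋`-paths of open/closed sites of the centred annulus `triAnn (s+1) (2s)` / hexagon
  `triBall (2s)` of the translated configuration `{z | z + x ∈ ω}` (`pathIn_triGraph_shift_iff`, layer lemmas);
* §2 the degenerate radii: `TPinch x x 0 0 = ∅` (tree) and `TPinch x x 1 1 = ∅` (`tPinch_one_eq_empty`: the collar is
  the single ring `|· - x| = 2`, every site of which is a one-site "crossing" of both colours, and the two halves of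
  `TwoCrossingClusters` cannot both hold for both colours);
* §3 `s ≥ 2`: "at least one hook-up" is the existence half of disc duality
  (`Literature.….exists_closed_crossings_joined_through_ball`, p164513: the frontier of the open `Λ_{2s}`-cluster of one
  open arm facing the other, read off a boundary traversal in the hexagon), "at most one" is the exclusivity half
  (`triBall_not_interleaved_shift`) applied to the certified alternating order of the frontier chains of
  `Literature.….exists_frontierChains_alternating_of_lt` (p164150, the thin-annulus sharpening `n < N` of
  `AnnulusAlternation.lean`, needed at `s = 2` where the collar has two rings).

Sorry-free; no `Prop` definition is introduced or used as a hypothesis.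
-/

noncomputable section

namespace Summit.CriticalPhenomena.CardyFormulaZ2.Cruxes.NestingRigidity.PinchResampling

open Summit.CriticalPhenomena.CardyFormulaZ2.Theses.CardyMagicRigidity
open Set Literature.Probability.Percolation Literature.Probability.LatticeModels

/-! ## §1 Dictionary: cluster-form objects at centre `x` versus `𝕋`-paths at the origin -/

section Dictionary

/-- The closed colour graph of `ω` is the open graph of `ωᶜ`. -/
theorem tColourGraph_false (ω : SiteConfig (Site 2)) : tColourGraph ω false = tColourGraph ωᶜ true := by
  have h : {u : Site 2 | (u ∈ ω) = false} = {u : Site 2 | (u ∈ ωᶜ) = true} := by ext u; simp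
  rw [tColourGraph, tColourGraph, h]

/-- A colour-`c` path from a site of colour `c` is a `𝕋`-path of colour-`c` sites (`η = ω` or `ωᶜ`). -/
theorem pathIn_inter_of_pathIn_colour {ω : SiteConfig (Site 2)} {c : Bool} {A : Set (Site 2)} {u v : Site 2}
    (h : PathIn (tColourGraph ω c) A u v) (hu : (u ∈ ω) = c) :
    PathIn triGraph (A ∩ (if c then ω else ωᶜ)) u v := by
  cases c
  · rw [tColourGraph_false] at h
    exact NeckCoarse.pathIn_inter_of_pathIn_open h (by simpa using hu)
  · exact NeckCoarse.pathIn_inter_of_pathIn_open h (by simpa using hu)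

/-- A `𝕋`-path of colour-`c` sites is a colour-`c` path. -/
theorem pathIn_colour_of_pathIn_inter {ω : SiteConfig (Site 2)} {c : Bool} {A : Set (Site 2)} {u v : Site 2}
    (h : PathIn triGraph (A ∩ (if c then ω else ωᶜ)) u v) : PathIn (tColourGraph ω c) A u v := by
  cases c
  · rw [tColourGraph_false]; exact NeckCoarse.pathIn_open_of_pathIn_inter (by simpa using h)
  · exact NeckCoarse.pathIn_open_of_pathIn_inter (by simpa using h)

/-- A nontrivial colour-`c` path starts at a site of colour `c`. -/
theorem colour_of_pathIn_ne {ω : SiteConfig (Site 2)} {c : Bool} {A : Set (Site 2)} {u v : Site 2}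
    (h : PathIn (tColourGraph ω c) A u v) (huv : u ≠ v) : (u ∈ ω) = c := by
  obtain ⟨b, hb⟩ := exists_adj_of_pathIn_ne h huv
  rw [tColourGraph, siteOpenGraph_adj] at hb
  exact hb.2.1

/-- **Translation of `𝕋`-paths**: a path inside `T` is a path inside `T - x` after translating by `-x`. -/
theorem pathIn_triGraph_shift_iff (x : Site 2) (T : Set (Site 2)) (u w : Site 2) :
    PathIn triGraph T u w ↔ PathIn triGraph {z | z + x ∈ T} (u - x) (w - x) := by
  constructor
  · intro h
    have := pathIn_shift (-x) (B := {z | z + x ∈ T}) (fun z hz ↦ by simpa using hz) h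
    simpa [sub_eq_add_neg] using this
  · intro h
    simpa using pathIn_shift x (B := T) (fun z hz ↦ hz) h

/-- The translated collar of colour class `η` is the centred annulus `{s+1 ≤ |·| ≤ 2s}` of the translated class. -/
theorem shift_collar_inter (x : Site 2) (s : ℕ) (η : Set (Site 2)) :
    {z | z + x ∈ (tBall x (2 * s) \ tBall x s) ∩ η} = triAnn (s + 1) (2 * s) ∩ {z | z + x ∈ η} := by
  ext z
  simp only [tBall, mem_setOf_eq, mem_inter_iff, mem_sdiff, add_sub_cancel_right, mem_triAnn, not_le]
  push_cast
  constructor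
  · rintro ⟨⟨h1, h2⟩, h3⟩; exact ⟨⟨by omega, h1⟩, h3⟩
  · rintro ⟨⟨h1, h2⟩, h3⟩; exact ⟨⟨h2, by omega⟩, h3⟩

/-- The translated big ball of colour class `η` is the centred hexagon `Λ_{2s}` of the translated class. -/
theorem shift_ball_inter (x : Site 2) (s : ℕ) (η : Set (Site 2)) :
    {z | z + x ∈ tBall x (2 * s) ∩ η} = (↑(triBall (2 * s)) : Set (Site 2)) ∩ {z | z + x ∈ η} := by
  ext z
  simp only [tBall, mem_setOf_eq, mem_inter_iff, add_sub_cancel_right, Finset.mem_coe, mem_triBall_iff]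

/-- The translated complement class is the complement of the translated class. -/
theorem shift_compl (x : Site 2) (ω : Set (Site 2)) : {z : Site 2 | z + x ∈ ωᶜ} = {z : Site 2 | z + x ∈ ω}ᶜ := by
  ext z; rfl

/-- **The inner layer of the collar** is the ring `|· - x| = s + 1` (`s ≥ 1`). -/
theorem mem_innerLayer_collar_iff {x : Site 2} {s : ℕ} (hs : 1 ≤ s) (v : Site 2) :
    v ∈ innerLayer triGraph (tBall x s) (tBall x (2 * s)) ↔ triNorm (v - x) = s + 1 := by
  constructor
  · rintro ⟨⟨hvO, hvI⟩, w, hw, hvw⟩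
    simp only [tBall, mem_setOf_eq, not_le] at hvO hvI hw
    have := triNorm_sub_le_of_adj hvw.symm x
    omega
  · intro hv
    obtain ⟨h, hadj, hh⟩ := exists_adj_mem_triBall_sub_one (r := s + 1) (by omega) hv
    refine ⟨⟨?_, ?_⟩, h + x, ?_, ?_⟩
    · simp only [tBall, mem_setOf_eq]; push_cast; omega
    · simp only [tBall, mem_setOf_eq]; omega
    · simp only [tBall, mem_setOf_eq, add_sub_cancel_right]
      have := hh; push_cast [Nat.add_sub_cancel] at this; omega
    · have := (triGraph_adj_shift_iff x (v - x) h).2 hadj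
      simpa [Site.shift_apply] using this

/-- **The outer layer of the collar** is the ring `|· - x| = 2s` (`s ≥ 1`). -/
theorem mem_outerLayer_collar_iff {x : Site 2} {s : ℕ} (hs : 1 ≤ s) (v : Site 2) :
    v ∈ outerLayer triGraph (tBall x s) (tBall x (2 * s)) ↔ triNorm (v - x) = 2 * s := by
  constructor
  · rintro ⟨⟨hvO, -⟩, w, hw, hvw⟩
    simp only [tBall, mem_setOf_eq, not_le] at hvO hw
    have := triNorm_sub_le_of_adj hvw x
    push_cast at hvO hw ⊢
    omega
  · intro hv
    obtain ⟨w, hadj, hw⟩ := exists_adj_triNorm_eq_add_one (v - x)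
    refine ⟨⟨?_, ?_⟩, w + x, ?_, ?_⟩
    · simp only [tBall, mem_setOf_eq]; push_cast; omega
    · simp only [tBall, mem_setOf_eq]; omega
    · simp only [tBall, mem_setOf_eq, add_sub_cancel_right, not_le]; push_cast; omega
    · have := (triGraph_adj_shift_iff x (v - x) w).2 hadj
      simpa [Site.shift_apply] using this

/-- **A crossing of colour `c` of the collar, read at the origin**: a `𝕋`-path of colour-`c` sites of the centred
annulus `{s+1 ≤ |·| ≤ 2s}` of the translated configuration, from `∂Λ_{s+1}` to `∂Λ_{2s}` (`s ≥ 2`, so that the two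
layers are distinct rings and the crossing path is nontrivial). -/
theorem exists_pathIn_of_isCrossing {ω : SiteConfig (Site 2)} {c : Bool} {x : Site 2} {s : ℕ} (hs : 2 ≤ s) {v : Site 2}
    (hv : IsCrossing triGraph (tColourGraph ω c) (tBall x s) (tBall x (2 * s)) v) :
    triNorm (v - x) = s + 1 ∧ (v ∈ ω) = c ∧ ∃ t : Site 2, triNorm (t - x) = 2 * s ∧
      PathIn triGraph (triAnn (s + 1) (2 * s) ∩ {z | z + x ∈ (if c then ω else ωᶜ)}) (v - x) (t - x) := by
  obtain ⟨hvin, w, hw, hp⟩ := hv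
  have hvn := (mem_innerLayer_collar_iff (by omega) v).1 hvin
  have hwN := (mem_outerLayer_collar_iff (by omega) w).1 hw
  have hne : v ≠ w := by rintro rfl; omega
  have hcol := colour_of_pathIn_ne hp hne
  refine ⟨hvn, hcol, w, hwN, ?_⟩
  rw [← shift_collar_inter, ← pathIn_triGraph_shift_iff]
  exact pathIn_inter_of_pathIn_colour hp hcol

/-- Conversely, **a colour-`c` `𝕋`-path of the centred annulus from `∂Λ_{s+1}` to `∂Λ_{2s}` is a crossing** of the
collar of `x` after translating back (`s ≥ 1`). -/
theorem isCrossing_of_pathIn {ω : SiteConfig (Site 2)} {c : Bool} {x : Site 2} {s : ℕ} (hs : 1 ≤ s) {v t : Site 2}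
    (hv : triNorm v = s + 1) (ht : triNorm t = 2 * s)
    (hp : PathIn triGraph (triAnn (s + 1) (2 * s) ∩ {z | z + x ∈ (if c then ω else ωᶜ)}) v t) :
    IsCrossing triGraph (tColourGraph ω c) (tBall x s) (tBall x (2 * s)) (v + x) := by
  refine ⟨(mem_innerLayer_collar_iff hs _).2 (by simpa using hv), t + x,
    (mem_outerLayer_collar_iff hs _).2 (by simpa using ht), pathIn_colour_of_pathIn_inter ?_⟩
  rw [pathIn_triGraph_shift_iff x, shift_collar_inter]
  simpa using hp

/-- Colour-`c` paths of the big ball, read at the origin. -/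
theorem pathIn_ball_iff {ω : SiteConfig (Site 2)} {c : Bool} {x : Site 2} {s : ℕ} {u v : Site 2} (hu : (u ∈ ω) = c) :
    PathIn (tColourGraph ω c) (tBall x (2 * s)) u v ↔
      PathIn triGraph ((↑(triBall (2 * s)) : Set (Site 2)) ∩ {z | z + x ∈ (if c then ω else ωᶜ)}) (u - x) (v - x) := by
  rw [← shift_ball_inter, ← pathIn_triGraph_shift_iff]
  exact ⟨fun h ↦ pathIn_inter_of_pathIn_colour h hu, pathIn_colour_of_pathIn_inter⟩

/-- Colour-`c` paths of the collar, read at the origin. -/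
theorem pathIn_collar_iff {ω : SiteConfig (Site 2)} {c : Bool} {x : Site 2} {s : ℕ} {u v : Site 2} (hu : (u ∈ ω) = c) :
    PathIn (tColourGraph ω c) (tBall x (2 * s) \ tBall x s) u v ↔
      PathIn triGraph (triAnn (s + 1) (2 * s) ∩ {z | z + x ∈ (if c then ω else ωᶜ)}) (u - x) (v - x) := by
  rw [← shift_collar_inter, ← pathIn_triGraph_shift_iff]
  exact ⟨fun h ↦ pathIn_inter_of_pathIn_colour h hu, pathIn_colour_of_pathIn_inter⟩

end Dictionary

/-! ## §2 The degenerate radius `s = 1`: the collar is a single ring and cannot be clean -/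

section Degenerate

/-- **`TPinch x x 1 1 = ∅`.**  The collar `Λ_2(x) ∖ Λ_1(x)` is the ring `|· - x| = 2`; every ring site lies on both
layers, hence is a (one-site) crossing of BOTH colours; the ring carries an open and a closed site (two ring sites not
joined along the all-open ring would contradict `pathIn_triSphere`), and then with any third ring site the
"two-of-three-joined" clause of `TwoCrossingClusters` fails for one of the colours (a nontrivial colour-`c` path has
both ends of colour `c`). -/
theorem tPinch_one_eq_empty (x : Site 2) : TPinch x x 1 1 = ∅ := by
  ext ω
  simp only [mem_empty_iff_false, iff_false]
  rintro ⟨⟨⟨v₁, v₂, hv₁, hv₂, hn12⟩, hopen⟩, ⟨⟨w₁, w₂, hw₁, hw₂, hm12⟩, hclosed⟩⟩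
  -- every ring site is a crossing of both colours
  have ring_cross : ∀ (c : Bool) (v : Site 2), triNorm (v - x) = 2 →
      IsCrossing triGraph (tColourGraph ω c) (tBall x 1) (tBall x (2 * 1)) v := fun c v hv ↦
    ⟨(mem_innerLayer_collar_iff le_rfl v).2 hv, v, (mem_outerLayer_collar_iff le_rfl v).2 hv,
      PathIn.refl ((mem_innerLayer_collar_iff le_rfl v).2 hv).1⟩
  have norm_of_cross : ∀ {c : Bool} {v : Site 2}, IsCrossing triGraph (tColourGraph ω c) (tBall x 1) (tBall x (2 * 1)) v →
      triNorm (v - x) = 2 := fun hv ↦ (mem_innerLayer_collar_iff le_rfl _).1 hv.1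
  -- endpoints of nontrivial colour paths
  have ends : ∀ {c : Bool} {A : Set (Site 2)} {u v : Site 2}, PathIn (tColourGraph ω c) A u v → u ≠ v →
      (u ∈ ω) = c ∧ (v ∈ ω) = c := fun hp huv ↦
    ⟨colour_of_pathIn_ne hp huv, colour_of_pathIn_ne hp.symm huv.symm⟩
  -- along an all-`c` ring any two ring sites are joined by a colour-`c` path of the collar
  have ring_join : ∀ (c : Bool), (∀ v : Site 2, triNorm (v - x) = 2 → (v ∈ ω) = c) →
      ∀ u v : Site 2, triNorm (u - x) = 2 → triNorm (v - x) = 2 →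
        PathIn (tColourGraph ω c) (tBall x (2 * 1) \ tBall x 1) u v := by
    intro c hall u v hu hv
    rw [pathIn_collar_iff (hall u hu)]
    refine (pathIn_triSphere (K := 2) (by norm_num) hu hv).mono fun z hz ↦ ⟨mem_triAnn.2 ⟨?_, ?_⟩, ?_⟩
    · have h : triNorm z = 2 := hz; omega
    · have h : triNorm z = 2 := hz; omega
    · have h := hall (z + x) (by simpa using hz)
      cases c
      · simpa using h
      · simpa using h
  -- a closed ring site and an open ring site
  have hv₁2 := norm_of_cross hv₁
  obtain ⟨cl, hcl2, hcl⟩ : ∃ cl : Site 2, triNorm (cl - x) = 2 ∧ cl ∉ ω := by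
    by_contra hno
    push Not at hno
    exact hn12 (ring_join true (fun v hv ↦ by simpa using hno v hv) v₁ v₂ hv₁2 (norm_of_cross hv₂))
  obtain ⟨op, hop2, hop⟩ : ∃ op : Site 2, triNorm (op - x) = 2 ∧ op ∈ ω := by
    by_contra hno
    push Not at hno
    exact hm12 (ring_join false (fun v hv ↦ by simpa using hno v hv) w₁ w₂ (norm_of_cross hw₁) (norm_of_cross hw₂))
  -- a third ring site (three pairwise distinct ring sites cannot all lie in `{cl, op}`)
  obtain ⟨th, hth2, hth_cl, hth_op⟩ : ∃ th : Site 2, triNorm (th - x) = 2 ∧ th ≠ cl ∧ th ≠ op := by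
    by_contra hno
    push Not at hno
    have key : ∀ a b : ℤ, triNorm ![a, b] = 2 → (![a, b] + x = cl ∨ ![a, b] + x = op) := fun a b hab ↦ by
      by_cases h : ![a, b] + x = cl
      · exact Or.inl h
      · exact Or.inr (hno _ (by rwa [add_sub_cancel_right]) h)
    have d12 : (![2, 0] : Site 2) + x ≠ ![0, 2] + x := fun e ↦ by
      have := congrFun (add_right_cancel e) 0; simp at this
    have d13 : (![2, 0] : Site 2) + x ≠ ![-2, 0] + x := fun e ↦ by
      have := congrFun (add_right_cancel e) 0; simp at this
    have d23 : (![0, 2] : Site 2) + x ≠ ![-2, 0] + x := fun e ↦ by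
      have := congrFun (add_right_cancel e) 0; simp at this
    rcases key 2 0 (by norm_num [triNorm]) with h1 | h1 <;> rcases key 0 2 (by norm_num [triNorm]) with h2 | h2 <;>
      rcases key (-2) 0 (by norm_num [triNorm]) with h3 | h3
    all_goals first
      | exact d12 (h1.trans h2.symm) | exact d13 (h1.trans h3.symm) | exact d23 (h2.trans h3.symm)
  -- the contradiction: with the third site, two-of-three fails for one colour
  have hclop : cl ≠ op := fun e ↦ hcl (e ▸ hop)
  by_cases hth : th ∈ ω
  · -- `op, th` open, `cl` closed: no closed path joins any two of them
    rcases hclosed op th cl (ring_cross false op hop2) (ring_cross false th hth2) (ring_cross false cl hcl2) with h | h | h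
    · exact absurd (ends h hth_op.symm).1 (by simp [hop])
    · exact absurd (ends h hclop.symm).1 (by simp [hop])
    · exact absurd (ends h hth_cl).1 (by simp [hth])
  · -- `cl, th` closed, `op` open: no open path joins any two of them
    rcases hopen cl th op (ring_cross true cl hcl2) (ring_cross true th hth2) (ring_cross true op hop2) with h | h | h
    · exact absurd (ends h hth_cl.symm).1 (by simp [hcl])
    · exact absurd (ends h hclop).1 (by simp [hcl])
    · exact absurd (ends h hth_op).1 (by simp [hth])

end Degenerate

/-! ## §3 The registered anchor -/

section Main

/-- **Registered anchor: disc duality at a clean collar (`TDiscDuality`).**  On `TPinch x x s s`, the open crossings of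
the collar `Λ_{2s}(x) ∖ Λ_s(x)` are not all joined by an open path of `Λ_{2s}(x)` iff the closed crossings are all
joined by a closed path of `Λ_{2s}(x)`.  (`s ≤ 1`: the event is empty.  `s ≥ 2`, AT LEAST ONE: if two open crossings
`a, g` — necessarily in the two distinct open crossing clusters — are not joined through the ball, the frontier of the
open `Λ_{2s}`-cluster of `a` facing `g` is a closed path through the ball joining two closed crossings of distinct
closed clusters, `exists_closed_crossings_joined_through_ball`, whence all closed crossings are joined,
`hookedUp_of_pathIn_of_not_pathIn`.  AT MOST ONE: the closed frontier chains `σ₁ ⇝ τ₁`, `τ₂ ⇝ σ₂` of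
`exists_frontierChains_alternating_of_lt` between the two open arms `a ⇝ t_a`, `g ⇝ t_g` satisfy
`τ₁ < t_g < τ₂ < t_a` around `∂Λ_{2s}`; both hook-ups would give an open path `t_g ⇝ t_a` and a closed path
`τ₁ ⇝ τ₂` of the hexagon, interleaved — impossible by `triBall_not_interleaved_shift`.) -/
theorem tDiscDuality_holds : TDiscDuality := by
  intro ω x s hpinch
  rcases Nat.lt_or_ge s 2 with hs | hs
  · exfalso
    interval_cases s
    · rw [tPinch_eq_empty_of_zero (by simp)] at hpinch; exact hpinch
    · rw [tPinch_one_eq_empty] at hpinch; exact hpinch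
  have hfa : TFourArms ω (tBall x s) (tBall x (2 * s)) := hpinch
  obtain ⟨hTo, hTc⟩ := hfa
  -- `s ≥ 2`: work at the origin with the translated configuration
  set ω₀ : Set (Site 2) := {z | z + x ∈ ω} with hω₀
  have hn : 1 ≤ s + 1 := by omega
  have hnN : s + 1 < 2 * s := by omega
  have hN : 1 ≤ 2 * s := by omega
  have hift : ∀ c : Bool, {z : Site 2 | z + x ∈ (if c then ω else ωᶜ)} = (if c then ω₀ else ω₀ᶜ) := by
    intro c; cases c
    · exact shift_compl x ω
    · rfl
  simp only [THook, mem_setOf_eq]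
  constructor
  · -- AT LEAST ONE: not open-hooked ⟹ closed-hooked
    intro hno
    simp only [HookedUp, not_forall] at hno
    obtain ⟨a, g, ha, hg, hag⟩ := hno
    obtain ⟨han, hacol, ta, hta, hB₁⟩ := exists_pathIn_of_isCrossing hs ha
    obtain ⟨hgn, hgcol, tg, htg, hB₂⟩ := exists_pathIn_of_isCrossing hs hg
    rw [hift] at hB₁ hB₂
    simp only [↓reduceIte] at hB₁ hB₂
    have hsep : ¬ PathIn triGraph ((↑(triBall (2 * s)) : Set (Site 2)) ∩ ω₀) (a - x) (g - x) := by
      intro h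
      refine hag ((pathIn_ball_iff hacol).2 ?_)
      rw [hift]; simpa using h
    obtain ⟨w₁, w₂, r, r', hw₁n, hw₂n, hrN, hr'N, hw₁r, hw₂r', hnj, hj⟩ :=
      exists_closed_crossings_joined_through_ball hn hnN han hta hgn htg hB₁ hB₂ hsep
    have hw₁c : (w₁ + x ∈ ω) = false := by
      have h : w₁ + x ∉ ω := hw₁r.left_mem.2
      simp [h]
    have hW₁ : IsCrossing triGraph (tColourGraph ω false) (tBall x s) (tBall x (2 * s)) (w₁ + x) :=
      isCrossing_of_pathIn (c := false) (by omega) hw₁n hrN (by rw [hift]; simpa [Set.sdiff_eq] using hw₁r)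
    have hW₂ : IsCrossing triGraph (tColourGraph ω false) (tBall x s) (tBall x (2 * s)) (w₂ + x) :=
      isCrossing_of_pathIn (c := false) (by omega) hw₂n hr'N (by rw [hift]; simpa [Set.sdiff_eq] using hw₂r')
    refine hookedUp_of_pathIn_of_not_pathIn hTc hW₁ hW₂ (fun h ↦ hnj ?_) ?_
    · have := (pathIn_collar_iff hw₁c).1 h
      rw [hift] at this
      simpa [Set.sdiff_eq] using this
    · refine (pathIn_ball_iff hw₁c).2 ?_
      rw [hift]
      simpa [Set.sdiff_eq] using hj
  · -- AT MOST ONE: closed-hooked ⟹ not open-hooked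
    intro hcl hop
    obtain ⟨⟨a, g, ha, hg, hag⟩, -⟩ := hTo
    obtain ⟨han, hacol, ta, hta, hB₁⟩ := exists_pathIn_of_isCrossing hs ha
    obtain ⟨hgn, hgcol, tg, htg, hB₂⟩ := exists_pathIn_of_isCrossing hs hg
    rw [hift] at hB₁ hB₂
    simp only [↓reduceIte] at hB₁ hB₂
    have hsepA : ¬ PathIn triGraph (triAnn (s + 1) (2 * s) ∩ ω₀) (a - x) (g - x) := by
      intro h
      refine hag ((pathIn_collar_iff hacol).2 ?_)
      rw [hift]; simpa using h
    obtain ⟨F, -, h0, h1, h2⟩ := exists_frontierChains_alternating_of_lt hn hnN hB₁ han hta hB₂ hgn htg hsepA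
    -- the chains are closed crossings; the closed hook-up joins `σ₁` to `σ₂` through the hexagon
    have hch₁ : PathIn triGraph (triAnn (s + 1) (2 * s) \ ω₀) F.σ₁ F.τ₁ := F.chain₁.mono annFrontier_subset
    have hch₂ : PathIn triGraph (triAnn (s + 1) (2 * s) \ ω₀) F.σ₂ F.τ₂ := (F.chain₂.mono annFrontier_subset).symm
    have hσ₁c : (F.σ₁ + x ∈ ω) = false := by
      have h : F.σ₁ + x ∉ ω := hch₁.left_mem.2
      simp [h]
    have hS₁ : IsCrossing triGraph (tColourGraph ω false) (tBall x s) (tBall x (2 * s)) (F.σ₁ + x) :=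
      isCrossing_of_pathIn (c := false) (by omega) F.norm_σ₁ F.norm_τ₁ (by rw [hift]; simpa [Set.sdiff_eq] using hch₁)
    have hS₂ : IsCrossing triGraph (tColourGraph ω false) (tBall x s) (tBall x (2 * s)) (F.σ₂ + x) :=
      isCrossing_of_pathIn (c := false) (by omega) F.norm_σ₂ F.norm_τ₂ (by rw [hift]; simpa [Set.sdiff_eq] using hch₂)
    have hσσ : PathIn triGraph ((↑(triBall (2 * s)) : Set (Site 2)) \ ω₀) F.σ₁ F.σ₂ := by
      have := (pathIn_ball_iff hσ₁c).1 (hcl _ _ hS₁ hS₂)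
      rw [hift] at this
      simpa [Set.sdiff_eq] using this
    have hag' : PathIn triGraph ((↑(triBall (2 * s)) : Set (Site 2)) ∩ ω₀) (a - x) (g - x) := by
      have := (pathIn_ball_iff hacol).1 (hop a g ha hg)
      rw [hift] at this
      simpa using this
    -- interleaved: closed `τ₁ ⇝ σ₁ ⇝ σ₂ ⇝ τ₂` against open `tg ⇝ g ⇝ a ⇝ ta`
    have toBall : ∀ {B : Set (Site 2)} {u v : Site 2}, PathIn triGraph (triAnn (s + 1) (2 * s) ∩ B) u v →
        PathIn triGraph ((↑(triBall (2 * s)) : Set (Site 2)) ∩ B) u v := fun hp ↦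
      hp.mono fun z hz ↦ ⟨Finset.mem_coe.2 (mem_triBall_iff.2 (mem_triAnn.1 hz.1).2), hz.2⟩
    have hP : PathIn triGraph ((↑(triBall (2 * s)) : Set (Site 2)) ∩ ω₀ᶜ) F.τ₁ F.τ₂ := by
      have e : triAnn (s + 1) (2 * s) \ ω₀ = triAnn (s + 1) (2 * s) ∩ ω₀ᶜ := Set.sdiff_eq _ _
      rw [e] at hch₁ hch₂
      have hσσ' : PathIn triGraph ((↑(triBall (2 * s)) : Set (Site 2)) ∩ ω₀ᶜ) F.σ₁ F.σ₂ := by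
        rwa [Set.sdiff_eq] at hσσ
      exact ((toBall hch₁).symm.trans hσσ').trans (toBall hch₂)
    have hQ : PathIn triGraph ((↑(triBall (2 * s)) : Set (Site 2)) ∩ ω₀ᶜᶜ) (tg - x) (ta - x) := by
      rw [compl_compl]
      exact ((toBall hB₂).symm.trans hag'.symm).trans (toBall hB₁)
    exact triBall_not_interleaved_shift hN ω₀ᶜ F.norm_τ₁ F.norm_τ₁ htg F.norm_τ₂ hta
      (by rw [hexShift_self]; exact h0) h1 h2 hP hQ

/-- **The closed dictionary for the realised states, now unconditional** (cf. `tGlue_false_tState_iff_reachable` of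
`…NestingRigidityTomographyDictionary`, whose displayed disc-duality hypothesis is `tDiscDuality_holds`): with
pairwise disjoint closed collars, two sites off the closed collars are closed-glued under the realised state vector
iff they lie in the same closed cluster of the full configuration. -/
theorem tGlue_false_tState_iff_reachable' {sc : Site 2 → ℕ} {X : Set (Site 2)} {ω : SiteConfig (Site 2)}
    (hdisj : ∀ x ∈ tSel sc X ω, ∀ y ∈ tSel sc X ω, x ≠ y → Disjoint (tBall x (2 * sc x)) (tBall y (2 * sc y)))
    {v w : Site 2} (hv : v ∉ tCollars sc X ω) (hw : w ∉ tCollars sc X ω) :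
    tGlue sc X ω false (tState sc X ω) v w ↔ (tColourGraph ω false).Reachable v w :=
  tGlue_iff_reachable hdisj (fun x hx ↦ by
    have h := tDiscDuality_holds ω x (sc x) hx.2
    simp only [tState, hx, true_and, decide_eq_false_iff_not]
    exact h) hv hw

end Main

end Summit.CriticalPhenomena.CardyFormulaZ2.Cruxes.NestingRigidity.PinchResampling

end
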